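import Summits.PneNP.PneNP.Theorems.ConvexRankGatesLinAlgGateBlindVisibleRigidity

/-!
# Route ConvexRankGates, crux `LinAlgGateBlind` (stmt-PneNP-10681): pair-pinned span programs are SG-trivial

Corollary file of `Theorems/ConvexRankGatesLinAlgGateBlindVisibleRigidity.lean` (`sg_of_pairLocalSpanProgram`), for
the research stub `stub_sgPerm`. A span-program term gate with unknowns on the PAIRS of vertices and local rows
(`c X e = 0` unless `e` is live for `X`) in which every pair atom `{u,v} ∈ 𝒱(l)` PINS its own unknown
(`c {u,v} (uv) ≠ 0`) is visibly rigid for the trivial property `P = True`: the row of a commonly present pair is,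
up to the target, the unit vector of that pair. Hence (`sg_of_pairPinnedSpanProgram`) some `𝒜 ⊆ 𝒱(l)` has
`lostPos m k O 𝒜 = ∅` AND `gainedNeg m q O 𝒜 = 0`: such a gate IS a small-clique DNF for both error measures,
whatever the rows of the larger atoms and the right-hand sides. In particular the refuters' clique-indicator parity
designs (`Cruxes/LinAlgGateBlind/DrefuteG2SGSharpening.md` §2(c)) are trivial as soon as the pair atoms themselves
carry their indicator rows; only the size-restricted versions (rows on `l`-sets only) need the affine criterion
`sg_of_affinelyRigidSpanProgram` together with a clique-generation lemma for dense graphs.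

Also recorded: the JOINT-SPAN CRITERION `sg_of_not_mem_jointSpan` (exact linear form of the main lemma, the
span-program counterpart of `PermRigidity.sg_of_not_mem_jointClosure`), and the elementary descriptions of liveness
and presence for a pair atom (`isLive_pair_iff`, `cliquePresent_pair_iff`). No new definitions. [folklore]
-/

-- `Summit.PneNP.PneNP.…` duplicates `PneNP` BY DESIGN (single-problem summit).
set_option linter.dupNamespace false

namespace Summit.PneNP.PneNP.Theorems

open Finset Literature.Computability.Complexity Razborov
open Summit.PneNP.PneNP.Cruxes.LinAlgGateBlind.DnfInvariantWideGatesSeeSmallCliques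

/-- The only live edge of a pair atom `{u,v}` is `uv`. [folklore] -/
theorem isLive_pair_iff {m : ℕ} {u v : Fin m} (huv : u ≠ v) (e : KEdge m) :
    IsLive ({u, v} : Finset (Fin m)) e ↔ (e : Sym2 (Fin m)) = s(u, v) := by
  revert e
  refine edge_ind fun p q hpq => ?_
  rw [isLive_mk]
  simp only [mem_insert, mem_singleton]
  constructor
  · rintro ⟨hp | hp, hq | hq⟩ <;> subst hp <;> subst hq
    · exact absurd rfl hpq
    · rfl
    · exact Sym2.eq_swap
    · exact absurd rfl hpq
  · intro h
    rcases Sym2.eq_iff.1 h with ⟨hp, hq⟩ | ⟨hp, hq⟩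
    · exact ⟨Or.inl hp, Or.inr hq⟩
    · exact ⟨Or.inr hp, Or.inl hq⟩

/-- A pair atom is present iff its edge is on. [folklore] -/
theorem cliquePresent_pair_iff {m : ℕ} {u v : Fin m} (huv : u ≠ v) (x : KEdge m → Bool) (e : KEdge m)
    (he : (e : Sym2 (Fin m)) = s(u, v)) :
    CliquePresent ({u, v} : Finset (Fin m)) x ↔ x e = true := by
  constructor
  · intro h
    exact h e ((isLive_pair_iff huv e).2 he)
  · intro h e' he'
    have : e' = e := Subtype.ext (((isLive_pair_iff huv e').1 he').trans he.symm)
    rw [this]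
    exact h

/-- **The joint-span criterion (exact linear form of the main lemma `sg_of_avoiding_subspace`; span-program
counterpart of `sg_of_not_mem_jointClosure`).** If the target is not in the span of the rows of all atoms that are
present in SOME rejected `P`-graph, SG holds with zero lost positives and `gainedNeg ≤ Pr[¬P]`. All the rigidity
criteria (`sg_of_rigidSpanProgram`, `sg_of_visiblyRigidSpanProgram`, `sg_of_affinelyRigidSpanProgram`) are
sufficient conditions for this hypothesis; contrapositively a span-program violator of `stub_sgPerm` has, for every
high-probability `P`, its target generated by rows each of which survives in some typical rejected graph.
[folklore] -/
theorem sg_of_not_mem_jointSpan :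
    ∀ (m l k : ℕ) (q : ℝ), 0 ≤ q → q ≤ 1 →
    ∀ {F V : Type} [DivisionRing F] [AddCommGroup V] [Module F V]
      (r : Finset (Fin m) → V) (t : V) (O : (KEdge m → Bool) → Bool),
      (∀ x, O x = true ↔
        t ∈ Submodule.span F (r '' {X | X ∈ smallSets (Fin m) l ∧ CliquePresent X x})) →
    ∀ (P : (KEdge m → Bool) → Prop),
      t ∉ Submodule.span F
          (r '' {X | X ∈ smallSets (Fin m) l ∧ ∃ G, P G ∧ O G = false ∧ CliquePresent X G}) →
      ∃ 𝒜 ⊆ smallSets (Fin m) l,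
        lostPos m k O 𝒜 = ∅ ∧ gainedNeg m q O 𝒜 ≤ prob q (fun G => ¬ P G) := by
  intro m l k q hq0 hq1 F V _ _ _ r t O hO P ht
  exact sg_of_avoiding_subspace hq0 hq1 r t O hO P _ ht fun G hPG hOG X hX hXG =>
    Submodule.subset_span ⟨X, ⟨hX, G, hPG, hOG, hXG⟩, rfl⟩

/-- **Pair-pinned span programs are small-clique DNFs on the nose (corollary of `sg_of_pairLocalSpanProgram`).**
Unknowns on pairs, local rows, `2 ≤ l`, and every pair atom pins its own unknown: then some `𝒜 ⊆ 𝒱(l)` has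
`lostPos m k O 𝒜 = ∅` and `gainedNeg m q O 𝒜 = 0`. [folklore] -/
theorem sg_of_pairPinnedSpanProgram :
    ∀ (m l k : ℕ) (q : ℝ), 0 ≤ q → q ≤ 1 → 2 ≤ l →
    ∀ {F : Type} [Field F]
      (c : Finset (Fin m) → KEdge m → F) (b : Finset (Fin m) → F) (O : (KEdge m → Bool) → Bool),
      (∀ x, O x = true ↔ ((0 : KEdge m → F), (1 : F)) ∈ Submodule.span F
        ((fun X : Finset (Fin m) => (c X, b X)) '' {X | X ∈ smallSets (Fin m) l ∧ CliquePresent X x})) →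
      (∀ (X : Finset (Fin m)) (e : KEdge m), ¬ IsLive X e → c X e = 0) →
      (∀ (e : KEdge m) (u v : Fin m), (e : Sym2 (Fin m)) = s(u, v) → c {u, v} e ≠ 0) →
      ∃ 𝒜 ⊆ smallSets (Fin m) l, lostPos m k O 𝒜 = ∅ ∧ gainedNeg m q O 𝒜 = 0 := by
  intro m l k q hq0 hq1 hl F _ c b O hO hloc hpin
  classical
  have key := sg_of_pairLocalSpanProgram m l k q hq0 hq1 c b O hO hloc (fun _ => True) (by
    -- visible rigidity for `P = True`: a commonly present pair pins its unit vector
    intro G G' _ _ e heG heG'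
    -- name the endpoints of `e`
    obtain ⟨u, v, huv, he⟩ : ∃ u v : Fin m, u ≠ v ∧ (e : Sym2 (Fin m)) = s(u, v) := by
      obtain ⟨e, hemem⟩ := e
      induction e using Sym2.ind with
      | _ u v => exact ⟨u, v, (SimpleGraph.mem_edgeSet _).1 hemem, rfl⟩
    set Y : Finset (Fin m) := {u, v} with hY
    have hYl : Y ∈ smallSets (Fin m) l :=
      mem_smallSets.2 ⟨by rw [hY, card_pair huv]; exact hl, by rw [hY, card_pair huv]; omega⟩
    have hYG : CliquePresent Y G := (cliquePresent_pair_iff huv G e he).2 heG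
    have hYG' : CliquePresent Y G' := (cliquePresent_pair_iff huv G' e he).2 heG'
    set M : Submodule F ((KEdge m → F) × F) := Submodule.span F
        ((fun X : Finset (Fin m) => (c X, b X)) ''
          {X | X ∈ smallSets (Fin m) l ∧ CliquePresent X G ∧ CliquePresent X G'})
      ⊔ Submodule.span F {((0 : KEdge m → F), (1 : F))} with hM
    have hrow : (c Y, b Y) ∈ M := Submodule.mem_sup_left (Submodule.subset_span ⟨Y, ⟨hYl, hYG, hYG'⟩, rfl⟩)
    have ht : ((0 : KEdge m → F), (1 : F)) ∈ M := Submodule.mem_sup_right (Submodule.subset_span rfl)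
    -- `c Y` is `c Y e` times the unit vector of `e`
    have hce : c Y e ≠ 0 := hpin e u v he
    set a : F := c Y e with ha
    have hcY : c Y = a • (Pi.single e (1 : F) : KEdge m → F) := by
      funext e'
      by_cases hee : e' = e
      · subst hee; simp [ha]
      · have hnl : ¬ IsLive Y e' := fun hl' =>
          hee (Subtype.ext (((isLive_pair_iff huv e').1 hl').trans he.symm))
        rw [hloc Y e' hnl, Pi.smul_apply, Pi.single_eq_of_ne hee, smul_zero]
    have hkey : ((Pi.single e (1 : F) : KEdge m → F), (0 : F)) =
        a⁻¹ • (c Y, b Y) - (a⁻¹ * b Y) • ((0 : KEdge m → F), (1 : F)) := by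
      refine Prod.ext ?_ ?_
      · simp only [Prod.fst_sub, Prod.smul_fst, smul_zero, sub_zero]
        rw [hcY, smul_smul, inv_mul_cancel₀ hce, one_smul]
      · simp only [Prod.snd_sub, Prod.smul_snd, smul_eq_mul, mul_one, sub_self]
    rw [hkey]
    exact M.sub_mem (M.smul_mem _ hrow) (M.smul_mem _ ht))
  obtain ⟨𝒜, h𝒜, hlost, hgain⟩ := key
  have h0 : gainedNeg m q O 𝒜 ≤ 0 :=
    calc gainedNeg m q O 𝒜 ≤ prob q (fun _ : KEdge m → Bool => ¬ True) := hgain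
      _ = 0 := by rw [prob_congr fun _ => not_true, prob_false]
  have h1 : 0 ≤ gainedNeg m q O 𝒜 := by
    unfold gainedNeg
    exact prob_nonneg hq0 hq1 _
  exact ⟨𝒜, h𝒜, hlost, le_antisymm h0 h1⟩

end Summit.PneNP.PneNP.Theorems
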